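import Mathlib.Analysis.Calculus.MeanValue
import Mathlib.Analysis.LocallyConvex.Separation
import Mathlib.Analysis.SpecialFunctions.Exp
import Mathlib.Topology.MetricSpace.HausdorffDistance
import HarnessLib

/-!
# Flow invariance of closed sets under the Nagumo subtangency condition (Brezis, Volkmann, Deimling)

Topic `Literature/Analysis/ODE` (namespace `Literature.Analysis.ODE`); companion of
`ConeInvariance.lean` (which has the coordinatewise / exterior one-sided forms). Here the classical
INTERIOR form is PROVED in a real Banach space, for arbitrary closed sets (no convexity):

* `mem_of_ode_of_subtangent` — **Deimling's Theorem 5.2 (ii)** (case `ω(t,ρ) = Lρ`; Brezis 1970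
  for autonomous fields, Volkmann, Martin 1973): `E` complete, `D ⊆ E` closed, `F` jointly
  continuous on `[a, b] × E` and `K`-Lipschitz in `x`, and the Nagumo–Brezis boundary condition
  `liminf_{δ→0+} δ⁻¹ dist(x + δF(t,x), D) = 0` for `t ∈ [a, b)`, `x ∈ D` ⇒ every solution of
  `u' = F(t, u)` on `[a, b]` with `u a ∈ D` stays in `D`.
* `subtangent_of_convex_of_functional` — **Deimling's Lemma 4.1, (4) ⇒ (3)**: for convex `D` and
  `x ∈ D`, if every functional attaining its supremum over `D` at `x` is `≤ 0` on `v`, then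
  `dist(x + δ v, D) ≤ εδ` for all small `δ` (Hahn–Banach, `geometric_hahn_banach_point_closed`).
* `mem_of_ode_of_convex_of_functional` — invariance of a closed convex `D` under condition (4).
* `mem_of_ode_of_wedge_of_dualWedge` — **the dual-wedge ("quasi-positivity") form for a closed
  wedge `W`** (Deimling's condition (7), Example 4.1 (ii)): `x ∈ W, ψ ∈ W*, ψ x = 0 ⇒ ψ(F(t,x)) ≥ 0`
  implies forward invariance of `W` — the statement requested for closed convex cones by
  definition item `defn-ClosedConvexConeInvariance` (route OrthantWake of NavierStokesRegularity),
  now with the interior condition and in a general Banach space.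

## Proof of the main theorem (Deimling §4.2, Lemma 4.2, made quantitative against the solution)

Fix `ε`. Euler polygons with CORNERS IN `D`: at a corner `(t, x)` a step `δ` is admissible if
`0 < δ ≤ δ̄(ε)`, `t + δ ≤ b` and `dist(x + δF(t,x), D) < (ε/2)δ` (possible by the boundary
condition); choose an admissible step at least HALF THE SUPREMUM of the admissible ones and a next
corner in `D` within `(ε/2)δ` of the Euler point (`Adm`, `Good`, `step`, `corner`). A discrete
Grönwall estimate against the given solution `u` (one-step Taylor remainder of `u` from the
uniform continuity of `F` on the compact set `[a,b] × u([a,b])` and the Lipschitz bound) gives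
`‖u(t_n) − x_n‖ ≤ ε (t_n − a) e^{K(t_n − a)}`; hence the corner velocities are bounded, the corners
form a Cauchy sequence and converge (completeness) to some `x* ∈ D` (closedness) while
`t_n ↑ t*`. If `t* < b`, the boundary condition at `(t*, x*)` and joint continuity give admissible
steps bounded below along the sequence, contradicting `t_{n+1} − t_n → 0`; so `t_n → b`, every
`τ < b` lies in a step, `dist(u τ, D) ≤ (C_u + (b−a)e^{K(b−a)}) ε`, and `ε → 0`, closedness and
continuity at `b` finish. The mesh `δ̄(ε)` and all constants are explicit; no existence theorem for
the ODE and no compactness in `E` is used. Completeness IS used (and needed: Deimling's Example 5.2).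

## Hypotheses, honestly

`F` is assumed `K`-Lipschitz in `x` on all of `E` for `t ∈ [a, b]` (uniform constant), jointly
continuous on `[a, b] × E`; the solution has right derivatives `HasDerivWithinAt u (F t (u t)) (Ici t) t`
on `[a, b)` and is continuous on `[a, b]` (Mathlib's ODE convention, as in `Gronwall.lean`).
-- TODO(general form): `F` locally Lipschitz (Deimling Thm 5.2 (ii) allows `ω(t, ·)` of Kamke
type); restrict to a ball around the compact trajectory. The boundary condition is the `liminf`
form, stated elementarily (`∀ ε δ₀ > 0, ∃ δ ∈ (0, δ₀), dist ≤ εδ`); it is only required at points of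
`D` and times in `[a, b)`.

## References

* K. Deimling, *Ordinary Differential Equations in Banach Spaces*, LNM 596 (1977): §4.1 Lemma 4.1,
  Example 4.1, pp. 49–50; §4.2 Lemma 4.2, pp. 51–52; §5.2 Thm 5.2, Example 5.2, pp. 68–69; §5.5
  Remarks (i)–(ii) (Bony, Brezis, Redheffer, Volkmann), pp. 73–74. [Deimling1977] (held; read).
* H. Brezis, *On a characterization of flow-invariant sets*, Comm. Pure Appl. Math. 23 (1970)
  261–263. [Brezis1970]
* P. Volkmann, Math. Ann. 203 (1973) 201–210. [Volkmann1973]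
* R. H. Martin, Trans. AMS 179 (1973) 399–414. [Martin1973]
-/

noncomputable section

open Set Metric Filter Function
open scoped NNReal Topology

namespace Literature.Analysis.ODE

section ClosedSet

variable {E : Type*} [NormedAddCommGroup E] [NormedSpace ℝ E]

/-- Displacement bound from a bound on the right derivative: `‖u s - u t‖ ≤ C (s - t)` for
`t ≤ s` in `[a, b]`. [folklore] -/
private theorem norm_sub_le_of_deriv_right_bound {u u' : ℝ → E} {a b C : ℝ}
    (hcont : ContinuousOn u (Icc a b)) (hderiv : ∀ t ∈ Ico a b, HasDerivWithinAt u (u' t) (Ici t) t)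
    (hC : ∀ t ∈ Ico a b, ‖u' t‖ ≤ C) {t s : ℝ} (ht : a ≤ t) (hts : t ≤ s) (hs : s ≤ b) :
    ‖u s - u t‖ ≤ C * (s - t) := by
  have h1 : ContinuousOn u (Icc t b) := hcont.mono (Icc_subset_Icc_left ht)
  have h2 : ∀ τ ∈ Ico t b, HasDerivWithinAt u (u' τ) (Ici τ) τ :=
    fun τ hτ => hderiv τ ⟨ht.trans hτ.1, hτ.2⟩
  have h3 : ∀ τ ∈ Ico t b, ‖u' τ‖ ≤ C := fun τ hτ => hC τ ⟨ht.trans hτ.1, hτ.2⟩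
  exact norm_image_sub_le_of_norm_deriv_right_le_segment h1 h2 h3 s ⟨hts, hs⟩

/-- One-step Taylor remainder for a right-differentiable curve: if the right derivative stays
within `η` of its value at `t` on `[t, s)`, then `‖u s - u t - (s - t) • u' t‖ ≤ η (s - t)`.
[folklore] -/
private theorem norm_sub_sub_smul_le {u u' : ℝ → E} {a b η : ℝ}
    (hcont : ContinuousOn u (Icc a b)) (hderiv : ∀ t ∈ Ico a b, HasDerivWithinAt u (u' t) (Ici t) t)
    {t s : ℝ} (ht : a ≤ t) (hts : t ≤ s) (hs : s ≤ b)
    (hη : ∀ τ ∈ Ico t s, ‖u' τ - u' t‖ ≤ η) :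
    ‖u s - u t - (s - t) • u' t‖ ≤ η * (s - t) := by
  -- apply the mean value inequality to `g τ = u τ - τ • u' t` on `[t, s]`
  set g : ℝ → E := fun τ => u τ - τ • u' t with hg
  have h1 : ContinuousOn g (Icc t s) :=
    (hcont.mono (Icc_subset_Icc ht hs)).sub (continuous_id.smul continuous_const).continuousOn
  have h2 : ∀ τ ∈ Ico t s, HasDerivWithinAt g (u' τ - u' t) (Ici τ) τ := by
    intro τ hτ
    have hd := hderiv τ ⟨ht.trans hτ.1, hτ.2.trans_le hs⟩
    have hs' : HasDerivWithinAt (fun τ : ℝ => τ • u' t) ((1 : ℝ) • u' t) (Ici τ) τ :=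
      (hasDerivWithinAt_id τ (Ici τ)).smul_const (u' t)
    have := hd.sub hs'
    simp only [one_smul] at this
    exact this
  have := norm_image_sub_le_of_norm_deriv_right_le_segment h1 h2 hη s ⟨hts, le_rfl⟩
  have hcalc : g s - g t = u s - u t - (s - t) • u' t := by
    simp only [hg]; rw [sub_smul]; abel
  rw [hcalc] at this
  exact this

/-- The discrete Grönwall step behind the corner error estimate:
`(1 + Kδ)·(ε(τ-a)e^{K(τ-a)}) + εδ ≤ ε(τ+δ-a)e^{K(τ+δ-a)}` for `δ, K, ε ≥ 0`, `a ≤ τ`. [folklore] -/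
private theorem gronwall_discrete_step {K ε a τ δ : ℝ} (hK : 0 ≤ K) (hε : 0 ≤ ε) (hτ : a ≤ τ)
    (hδ : 0 ≤ δ) :
    (1 + K * δ) * (ε * (τ - a) * Real.exp (K * (τ - a))) + ε * δ ≤
      ε * (τ + δ - a) * Real.exp (K * (τ + δ - a)) := by
  have h1 : 1 + K * δ ≤ Real.exp (K * δ) := by
    have := Real.add_one_le_exp (K * δ); linarith
  have h2 : (1 : ℝ) ≤ Real.exp (K * (τ + δ - a)) :=
    Real.one_le_exp (mul_nonneg hK (by linarith))
  have h3 : Real.exp (K * δ) * Real.exp (K * (τ - a)) = Real.exp (K * (τ + δ - a)) := by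
    rw [← Real.exp_add]; ring_nf
  have h4 : (1 + K * δ) * (ε * (τ - a) * Real.exp (K * (τ - a)))
      ≤ ε * (τ - a) * Real.exp (K * (τ + δ - a)) := by
    have h5 : 0 ≤ ε * (τ - a) := mul_nonneg hε (sub_nonneg.2 hτ)
    calc (1 + K * δ) * (ε * (τ - a) * Real.exp (K * (τ - a)))
        = (ε * (τ - a)) * ((1 + K * δ) * Real.exp (K * (τ - a))) := by ring
      _ ≤ (ε * (τ - a)) * (Real.exp (K * δ) * Real.exp (K * (τ - a))) :=
          mul_le_mul_of_nonneg_left (mul_le_mul_of_nonneg_right h1 (Real.exp_nonneg _)) h5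
      _ = ε * (τ - a) * Real.exp (K * (τ + δ - a)) := by rw [h3]
  have h6 : ε * δ ≤ ε * δ * Real.exp (K * (τ + δ - a)) := by
    have : 0 ≤ ε * δ := mul_nonneg hε hδ
    nlinarith
  calc (1 + K * δ) * (ε * (τ - a) * Real.exp (K * (τ - a))) + ε * δ
      ≤ ε * (τ - a) * Real.exp (K * (τ + δ - a)) + ε * δ * Real.exp (K * (τ + δ - a)) :=
        add_le_add h4 h6
    _ = ε * (τ + δ - a) * Real.exp (K * (τ + δ - a)) := by ring

/-! ### Euler polygons with corners in `D` (Deimling, Lemma 4.2): the corner sequence -/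

/-- Admissible step lengths at a corner `p = (t, x)`: positive, at most `δbar`, not beyond `b`, and
with the Euler point `x + δ F(t,x)` within `(ε/2)δ` of `D` (strictly). [folklore] -/
private def Adm (F : ℝ → E → E) (D : Set E) (ε δbar b : ℝ) (p : ℝ × E) (δ : ℝ) : Prop :=
  0 < δ ∧ δ ≤ δbar ∧ p.1 + δ ≤ b ∧ infDist (p.2 + δ • F p.1 p.2) D < ε / 2 * δ

/-- A good next corner `q` after `p`: its step is admissible and at least half the supremum of the
admissible steps, and `q.2 ∈ D` realises the distance bound. [folklore] -/
private def Good (F : ℝ → E → E) (D : Set E) (ε δbar b : ℝ) (p q : ℝ × E) : Prop :=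
  Adm F D ε δbar b p (q.1 - p.1) ∧ sSup {δ | Adm F D ε δbar b p δ} < 2 * (q.1 - p.1) ∧ q.2 ∈ D ∧
    ‖p.2 + (q.1 - p.1) • F p.1 p.2 - q.2‖ < ε / 2 * (q.1 - p.1)

open Classical in
/-- One Euler step (a good next corner if there is one, else stay). [folklore] -/
private def step (F : ℝ → E → E) (D : Set E) (ε δbar b : ℝ) (p : ℝ × E) : ℝ × E :=
  if h : ∃ q, Good F D ε δbar b p q then Classical.choose h else p

/-- The corner sequence of the Euler polygon issued from `p₀`. [folklore] -/
private def corner (F : ℝ → E → E) (D : Set E) (ε δbar b : ℝ) (p₀ : ℝ × E) : ℕ → ℝ × E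
  | 0 => p₀
  | n + 1 => step F D ε δbar b (corner F D ε δbar b p₀ n)

/-- `step` picks a good next corner when one exists. [folklore] -/
private theorem step_of_exists {F : ℝ → E → E} {D : Set E} {ε δbar b : ℝ} {p : ℝ × E}
    (h : ∃ q, Good F D ε δbar b p q) : Good F D ε δbar b p (step F D ε δbar b p) := by
  rw [step, dif_pos h]; exact Classical.choose_spec h

/-- `step` is stationary when no good next corner exists. [folklore] -/
private theorem step_of_not_exists {F : ℝ → E → E} {D : Set E} {ε δbar b : ℝ} {p : ℝ × E}
    (h : ¬ ∃ q, Good F D ε δbar b p q) : step F D ε δbar b p = p := by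
  rw [step, dif_neg h]

/-- **The core estimate.** Under the hypotheses of `mem_of_ode_of_subtangent` (with `a < b`) there
is a constant `C` such that `dist(u τ, D) ≤ C ε` for every `ε > 0` and every `τ ∈ [a, b)`: Euler
polygons with corners in `D` and mesh `≤ ε` exist on the whole of `[a, b)` (Deimling, Lemma 4.2 —
the corners cannot accumulate before `b` because `E` is complete, `D` closed and the subtangency
condition holds at the limit corner) and stay `O(ε)`-close to the solution by a discrete Grönwall
argument. [cite: Deimling1977, §4.2 Lemma 4.2, pp. 51–52; Brezis1970] -/
private theorem infDist_le_linear [CompleteSpace E] {D : Set E} (hD : IsClosed D)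
    {F : ℝ → E → E} {u : ℝ → E} {a b : ℝ} {K : ℝ≥0} (hab : a < b)
    (hF : ContinuousOn (uncurry F) (Icc a b ×ˢ univ))
    (hlip : ∀ t ∈ Icc a b, LipschitzWith K (F t))
    (htan : ∀ t ∈ Ico a b, ∀ x ∈ D, ∀ ε : ℝ, 0 < ε → ∀ δ₀ : ℝ, 0 < δ₀ →
      ∃ δ : ℝ, 0 < δ ∧ δ < δ₀ ∧ infDist (x + δ • F t x) D ≤ ε * δ)
    (hcont : ContinuousOn u (Icc a b))
    (hderiv : ∀ t ∈ Ico a b, HasDerivWithinAt u (F t (u t)) (Ici t) t)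
    (ha : u a ∈ D) :
    ∃ C : ℝ, ∀ ε : ℝ, 0 < ε → ∀ τ ∈ Ico a b, infDist (u τ) D ≤ C * ε := by
  have hDne : D.Nonempty := ⟨u a, ha⟩
  -- a bound `Cu` for the velocity `F t (u t)` on `[a, b]`
  have hFu : ContinuousOn (fun t => F t (u t)) (Icc a b) := by
    have h1 : ContinuousOn (fun t => (t, u t)) (Icc a b) := continuousOn_id.prodMk hcont
    have h2 : MapsTo (fun t => (t, u t)) (Icc a b) (Icc a b ×ˢ (univ : Set E)) :=
      fun t ht => ⟨ht, mem_univ _⟩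
    exact hF.comp h1 h2
  obtain ⟨Cu₀, hCu₀⟩ := isCompact_Icc.exists_bound_of_continuousOn hFu
  set Cu := max Cu₀ 0 with hCu_def
  have hCu0 : 0 ≤ Cu := le_max_right _ _
  have hCu : ∀ t ∈ Icc a b, ‖F t (u t)‖ ≤ Cu := fun t ht => (hCu₀ t ht).trans (le_max_left _ _)
  set B₀ := (b - a) * Real.exp (K * (b - a)) with hB₀_def
  have hB₀0 : 0 ≤ B₀ := mul_nonneg (by linarith) (Real.exp_nonneg _)
  refine ⟨Cu + B₀, fun ε hε τ hτ => ?_⟩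
  -- uniform continuity of `F` on the compact set `[a,b] × u([a,b])`
  set S : Set (ℝ × E) := Icc a b ×ˢ (u '' Icc a b) with hS_def
  have hS : IsCompact S := isCompact_Icc.prod (isCompact_Icc.image_of_continuousOn hcont)
  have hFS : ContinuousOn (uncurry F) S := hF.mono (prod_mono le_rfl (subset_univ _))
  obtain ⟨ρ, hρ, hUC⟩ := Metric.uniformContinuousOn_iff.1 (hS.uniformContinuousOn_of_continuous hFS)
    (ε / 4) (by positivity)
  -- the mesh `δbar`
  set δbar := min ε (min (ρ / 2) (ε / (4 * (K * Cu + 1)))) with hδbar_def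
  have hKCu : 0 ≤ (K : ℝ) * Cu := mul_nonneg K.2 hCu0
  have hδbar0 : 0 < δbar := by
    refine lt_min hε (lt_min (by linarith) (div_pos hε (by linarith)))
  have hδbarε : δbar ≤ ε := min_le_left _ _
  have hδbarρ : δbar < ρ := lt_of_le_of_lt ((min_le_right _ _).trans (min_le_left _ _)) (by linarith)
  have hδbarK : (K : ℝ) * Cu * δbar ≤ ε / 4 := by
    have h1 : δbar ≤ ε / (4 * (K * Cu + 1)) := (min_le_right _ _).trans (min_le_right _ _)
    calc (K : ℝ) * Cu * δbar ≤ (K * Cu) * (ε / (4 * (K * Cu + 1))) :=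
          mul_le_mul_of_nonneg_left h1 hKCu
      _ ≤ ε / 4 := by
          rw [mul_div_assoc', div_le_div_iff₀ (by linarith) (by norm_num : (0:ℝ) < 4)]
          nlinarith
  -- (KE) the one-step Taylor estimate along `u`
  have hKE : ∀ t ∈ Ico a b, ∀ s, t ≤ s → s ≤ b → s - t ≤ δbar →
      ‖u s - u t - (s - t) • F t (u t)‖ ≤ ε / 2 * (s - t) := by
    intro t ht s hts hsb hst
    refine norm_sub_sub_smul_le (u' := fun τ => F τ (u τ)) hcont hderiv ht.1 hts hsb ?_
    intro τ hτ
    have hτab : τ ∈ Icc a b := ⟨ht.1.trans hτ.1, (hτ.2.le.trans hsb)⟩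
    have h1 : ‖F τ (u τ) - F τ (u t)‖ ≤ ε / 4 := by
      have h2 : ‖u τ - u t‖ ≤ Cu * (τ - t) :=
        norm_sub_le_of_deriv_right_bound hcont hderiv (fun σ hσ => hCu σ (Ico_subset_Icc_self hσ))
          ht.1 hτ.1 hτab.2
      calc ‖F τ (u τ) - F τ (u t)‖ ≤ K * ‖u τ - u t‖ := by
            rw [← dist_eq_norm, ← dist_eq_norm]; exact (hlip τ hτab).dist_le_mul _ _
        _ ≤ K * (Cu * (τ - t)) := mul_le_mul_of_nonneg_left h2 K.2
        _ ≤ K * (Cu * δbar) := by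
            refine mul_le_mul_of_nonneg_left (mul_le_mul_of_nonneg_left ?_ hCu0) K.2
            linarith [hτ.2]
        _ = K * Cu * δbar := by ring
        _ ≤ ε / 4 := hδbarK
    have h3 : ‖F τ (u t) - F t (u t)‖ < ε / 4 := by
      have hp : (τ, u t) ∈ S := ⟨hτab, ⟨t, Ico_subset_Icc_self ht, rfl⟩⟩
      have hq : (t, u t) ∈ S := ⟨Ico_subset_Icc_self ht, ⟨t, Ico_subset_Icc_self ht, rfl⟩⟩
      have hd : dist (τ, u t) (t, u t) < ρ := by
        rw [Prod.dist_eq, dist_self, max_eq_left dist_nonneg, Real.dist_eq,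
          abs_of_nonneg (sub_nonneg.2 hτ.1)]
        linarith [hτ.2]
      have := hUC _ hp _ hq hd
      rwa [dist_eq_norm] at this
    calc ‖F τ (u τ) - F t (u t)‖ ≤ ‖F τ (u τ) - F τ (u t)‖ + ‖F τ (u t) - F t (u t)‖ :=
          norm_sub_le_norm_sub_add_norm_sub _ _ _
      _ ≤ ε / 2 := by linarith
  -- existence of good next corners
  have hgood : ∀ p : ℝ × E, a ≤ p.1 → p.1 < b → p.2 ∈ D → ∃ q, Good F D ε δbar b p q := by
    intro p hp1 hp2 hp3
    set A : Set ℝ := {δ | Adm F D ε δbar b p δ} with hA_def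
    have hAbdd : BddAbove A := ⟨δbar, fun δ hδ => hδ.2.1⟩
    obtain ⟨δ₁, hδ₁0, hδ₁lt, hδ₁dist⟩ := htan p.1 ⟨hp1, hp2⟩ p.2 hp3 (ε / 4) (by positivity)
      (min δbar (b - p.1)) (lt_min hδbar0 (by linarith))
    have hδ₁A : δ₁ ∈ A := by
      refine ⟨hδ₁0, (hδ₁lt.le.trans (min_le_left _ _)), by linarith [hδ₁lt.le.trans (min_le_right _ _)], ?_⟩
      calc infDist (p.2 + δ₁ • F p.1 p.2) D ≤ ε / 4 * δ₁ := hδ₁dist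
        _ < ε / 2 * δ₁ := by nlinarith
    have hAne : A.Nonempty := ⟨δ₁, hδ₁A⟩
    have hsup0 : 0 < sSup A := lt_of_lt_of_le hδ₁0 (le_csSup hAbdd hδ₁A)
    obtain ⟨δ, hδA, hδhalf⟩ := exists_lt_of_lt_csSup hAne (by linarith : sSup A / 2 < sSup A)
    -- a point of `D` realising the strict distance bound
    have hlt : infDist (p.2 + δ • F p.1 p.2) D < ε / 2 * δ := hδA.2.2.2
    obtain ⟨y, hyD, hy⟩ := (infDist_lt_iff hDne).1 hlt
    have hδA' : Adm F D ε δbar b p δ := hδA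
    refine ⟨(p.1 + δ, y), ?_, ?_, hyD, ?_⟩
    · simpa using hδA'
    · show sSup A < 2 * (p.1 + δ - p.1); linarith
    · simpa [dist_eq_norm] using hy
  -- the corner sequence and its invariants
  set c : ℕ → ℝ × E := corner F D ε δbar b (a, u a) with hc_def
  have hc0 : c 0 = (a, u a) := rfl
  have hcs : ∀ n, c (n + 1) = step F D ε δbar b (c n) := fun n => rfl
  have hI1 : ∀ n, a ≤ (c n).1 ∧ (c n).1 ≤ b ∧ (c n).2 ∈ D := by
    intro n
    induction n with
    | zero => exact ⟨by simp [hc0], by simp [hc0, hab.le], by simpa [hc0] using ha⟩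
    | succ n ih =>
      rw [hcs]
      by_cases hex : ∃ q, Good F D ε δbar b (c n) q
      · have hG := step_of_exists hex
        exact ⟨by linarith [hG.1.1, ih.1], hG.1.2.2.1.trans_eq' (by ring), hG.2.2.1⟩
      · rw [step_of_not_exists hex]; exact ih
  have hGood : ∀ n, (c n).1 < b → Good F D ε δbar b (c n) (c (n + 1)) := by
    intro n hn
    rw [hcs]
    exact step_of_exists (hgood _ (hI1 n).1 hn (hI1 n).2.2)
  have hstat : ∀ n, (c n).1 = b → c (n + 1) = c n := by
    intro n hn
    rw [hcs]
    refine step_of_not_exists ?_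
    rintro ⟨q, hq⟩
    have := hq.1.2.2.1
    have := hq.1.1
    linarith
  have hI2 : ∀ n, (c n).1 ≤ (c (n + 1)).1 := by
    intro n
    rcases (hI1 n).2.1.lt_or_eq with hlt | heq
    · linarith [(hGood n hlt).1.1]
    · rw [hstat n heq]
  -- notation
  set t : ℕ → ℝ := fun n => (c n).1 with ht_def
  set x : ℕ → E := fun n => (c n).2 with hx_def
  have htmono : Monotone t := monotone_nat_of_le_succ hI2
  -- (E) the corner error estimate by discrete Grönwall
  have hE : ∀ n, ‖u (t n) - x n‖ ≤ ε * (t n - a) * Real.exp (K * (t n - a)) := by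
    intro n
    induction n with
    | zero => simp [ht_def, hx_def, hc0]
    | succ n ih =>
      rcases (hI1 n).2.1.lt_or_eq with hlt | heq
      · have hG := hGood n hlt
        set δ := t (n + 1) - t n with hδ_def
        have hδ0 : 0 < δ := hG.1.1
        have hδbar' : δ ≤ δbar := hG.1.2.1
        have htb : t (n + 1) ≤ b := (hI1 (n + 1)).2.1
        have h1 := hKE (t n) ⟨(hI1 n).1, hlt⟩ (t (n + 1)) (by linarith) htb (by linarith)
        have h2 : ‖F (t n) (u (t n)) - F (t n) (x n)‖ ≤ K * ‖u (t n) - x n‖ := by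
          rw [← dist_eq_norm, ← dist_eq_norm]
          exact (hlip (t n) ⟨(hI1 n).1, (hI1 n).2.1⟩).dist_le_mul _ _
        have h3 : ‖x n + δ • F (t n) (x n) - x (n + 1)‖ < ε / 2 * δ := hG.2.2.2
        -- decomposition of `u (t (n+1)) - x (n+1)`
        have hdec : u (t (n + 1)) - x (n + 1) =
            (u (t (n + 1)) - u (t n) - δ • F (t n) (u (t n))) +
            ((u (t n) - x n) + δ • (F (t n) (u (t n)) - F (t n) (x n))) +
            (x n + δ • F (t n) (x n) - x (n + 1)) := by
          rw [smul_sub]; abel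
        have h4 : ‖(u (t n) - x n) + δ • (F (t n) (u (t n)) - F (t n) (x n))‖
            ≤ (1 + K * δ) * ‖u (t n) - x n‖ := by
          calc ‖(u (t n) - x n) + δ • (F (t n) (u (t n)) - F (t n) (x n))‖
              ≤ ‖u (t n) - x n‖ + ‖δ • (F (t n) (u (t n)) - F (t n) (x n))‖ := norm_add_le _ _
            _ ≤ ‖u (t n) - x n‖ + δ * (K * ‖u (t n) - x n‖) := by
                rw [norm_smul, Real.norm_eq_abs, abs_of_pos hδ0]
                exact add_le_add le_rfl (mul_le_mul_of_nonneg_left h2 hδ0.le)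
            _ = (1 + K * δ) * ‖u (t n) - x n‖ := by ring
        have hτ : t (n + 1) - t n = δ := rfl
        calc ‖u (t (n + 1)) - x (n + 1)‖
            ≤ ‖u (t (n + 1)) - u (t n) - δ • F (t n) (u (t n))‖ +
              ‖(u (t n) - x n) + δ • (F (t n) (u (t n)) - F (t n) (x n))‖ +
              ‖x n + δ • F (t n) (x n) - x (n + 1)‖ := by
                rw [hdec]; exact norm_add₃_le
          _ ≤ ε / 2 * δ + (1 + K * δ) * ‖u (t n) - x n‖ + ε / 2 * δ := by
                refine add_le_add (add_le_add (by simpa [hτ] using h1) h4) h3.le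
          _ = (1 + K * δ) * ‖u (t n) - x n‖ + ε * δ := by ring
          _ ≤ (1 + K * δ) * (ε * (t n - a) * Real.exp (K * (t n - a))) + ε * δ := by
                have : 0 ≤ 1 + (K : ℝ) * δ := by positivity
                nlinarith [ih]
          _ ≤ ε * (t n + δ - a) * Real.exp (K * (t n + δ - a)) :=
                gronwall_discrete_step K.2 hε.le (hI1 n).1 hδ0.le
          _ = ε * (t (n + 1) - a) * Real.exp (K * (t (n + 1) - a)) := by
                rw [hδ_def]; ring_nf
      · have : c (n + 1) = c n := hstat n heq
        simp only [ht_def, hx_def, this]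
        exact ih
  have hEB : ∀ n, ‖u (t n) - x n‖ ≤ ε * B₀ := by
    intro n
    refine (hE n).trans ?_
    rw [hB₀_def, ← mul_assoc]
    have h1 : t n - a ≤ b - a := by linarith [(hI1 n).2.1]
    have h2 : Real.exp (K * (t n - a)) ≤ Real.exp (K * (b - a)) :=
      Real.exp_le_exp.2 (mul_le_mul_of_nonneg_left h1 K.2)
    have h3 : 0 ≤ t n - a := by linarith [(hI1 n).1]
    calc ε * (t n - a) * Real.exp (K * (t n - a))
        ≤ ε * (b - a) * Real.exp (K * (t n - a)) :=
          mul_le_mul_of_nonneg_right (mul_le_mul_of_nonneg_left h1 hε.le) (Real.exp_nonneg _)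
      _ ≤ ε * (b - a) * Real.exp (K * (b - a)) :=
          mul_le_mul_of_nonneg_left h2 (mul_nonneg hε.le (by linarith))
  -- (V) corner displacements
  set c₂ := Cu + K * (ε * B₀) + ε / 2 with hc₂_def
  have hc₂0 : 0 ≤ c₂ := by positivity
  have hV : ∀ n, ‖x (n + 1) - x n‖ ≤ c₂ * (t (n + 1) - t n) := by
    intro n
    rcases (hI1 n).2.1.lt_or_eq with hlt | heq
    · have hG := hGood n hlt
      set δ := t (n + 1) - t n with hδ_def
      have hδ0 : 0 < δ := hG.1.1
      have h3 : ‖x n + δ • F (t n) (x n) - x (n + 1)‖ < ε / 2 * δ := hG.2.2.2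
      have hFx : ‖F (t n) (x n)‖ ≤ Cu + K * (ε * B₀) := by
        have h2 : ‖F (t n) (x n) - F (t n) (u (t n))‖ ≤ K * ‖x n - u (t n)‖ := by
          rw [← dist_eq_norm, ← dist_eq_norm]
          exact (hlip (t n) ⟨(hI1 n).1, (hI1 n).2.1⟩).dist_le_mul _ _
        have h5 : ‖x n - u (t n)‖ ≤ ε * B₀ := by rw [norm_sub_rev]; exact hEB n
        calc ‖F (t n) (x n)‖ ≤ ‖F (t n) (u (t n))‖ + ‖F (t n) (x n) - F (t n) (u (t n))‖ :=
              norm_le_norm_add_norm_sub' _ _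
          _ ≤ Cu + K * (ε * B₀) := add_le_add (hCu _ ⟨(hI1 n).1, (hI1 n).2.1⟩)
              (h2.trans (mul_le_mul_of_nonneg_left h5 K.2))
      calc ‖x (n + 1) - x n‖ = ‖(x (n + 1) - (x n + δ • F (t n) (x n))) + δ • F (t n) (x n)‖ := by
            congr 1; abel
        _ ≤ ‖x (n + 1) - (x n + δ • F (t n) (x n))‖ + ‖δ • F (t n) (x n)‖ := norm_add_le _ _
        _ ≤ ε / 2 * δ + δ * (Cu + K * (ε * B₀)) := by
            refine add_le_add ?_ ?_
            · rw [norm_sub_rev]; exact h3.le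
            · rw [norm_smul, Real.norm_eq_abs, abs_of_pos hδ0]
              exact mul_le_mul_of_nonneg_left hFx hδ0.le
        _ = c₂ * δ := by rw [hc₂_def]; ring
    · have : c (n + 1) = c n := hstat n heq
      simp [ht_def, hx_def, this]
  have hT : ∀ m n, m ≤ n → ‖x n - x m‖ ≤ c₂ * (t n - t m) := by
    intro m n hmn
    induction n, hmn using Nat.le_induction with
    | base => simp
    | succ n hmn ih =>
      calc ‖x (n + 1) - x m‖ ≤ ‖x (n + 1) - x n‖ + ‖x n - x m‖ := norm_sub_le_norm_sub_add_norm_sub _ _ _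
        _ ≤ c₂ * (t (n + 1) - t n) + c₂ * (t n - t m) := add_le_add (hV n) ih
        _ = c₂ * (t (n + 1) - t m) := by ring
  -- convergence of the corners
  have htbdd : BddAbove (range t) := ⟨b, by rintro _ ⟨n, rfl⟩; exact (hI1 n).2.1⟩
  set tstar := ⨆ n, t n with htstar_def
  have ht_tend : Tendsto t atTop (𝓝 tstar) := tendsto_atTop_ciSup htmono htbdd
  have ht_le : ∀ n, t n ≤ tstar := fun n => le_ciSup htbdd n
  have htstar_b : tstar ≤ b := ciSup_le fun n => (hI1 n).2.1
  have htstar_a : a ≤ tstar := le_trans (by simp [ht_def, hc0]) (ht_le 0)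
  have hxCauchy : CauchySeq x := by
    refine cauchySeq_of_le_tendsto_0 (fun N => c₂ * (tstar - t N)) (fun n m N hn hm => ?_) ?_
    · rcases le_total n m with hnm | hmn
      · rw [dist_comm, dist_eq_norm]
        refine (hT n m hnm).trans (mul_le_mul_of_nonneg_left ?_ hc₂0)
        linarith [ht_le m, htmono hn]
      · rw [dist_eq_norm]
        refine (hT m n hmn).trans (mul_le_mul_of_nonneg_left ?_ hc₂0)
        linarith [ht_le n, htmono hm]
    · have : Tendsto (fun N => c₂ * (tstar - t N)) atTop (𝓝 (c₂ * (tstar - tstar))) :=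
        (tendsto_const_nhds.sub ht_tend).const_mul c₂
      simpa using this
  obtain ⟨xstar, hx_tend⟩ := cauchySeq_tendsto_of_complete hxCauchy
  have hxstarD : xstar ∈ D := hD.mem_of_tendsto hx_tend (Eventually.of_forall fun n => (hI1 n).2.2)
  -- the corners reach (or accumulate only at) `b`
  have htstar_eq : tstar = b := by
    by_contra hne
    have hlt : tstar < b := lt_of_le_of_ne htstar_b hne
    obtain ⟨δs, hδs0, hδslt, hδsdist⟩ := htan tstar ⟨htstar_a, hlt⟩ xstar hxstarD (ε / 4)
      (by positivity) (min δbar ((b - tstar) / 2)) (lt_min hδbar0 (by linarith))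
    have hδs1 : δs ≤ δbar := hδslt.le.trans (min_le_left _ _)
    have hδs2 : δs < (b - tstar) / 2 := lt_of_lt_of_le hδslt (min_le_right _ _)
    -- continuity of the Euler point and of `infDist` at the limit corner
    have hcW : ∀ n, c n ∈ Icc a b ×ˢ (univ : Set E) := fun n => ⟨⟨(hI1 n).1, (hI1 n).2.1⟩, mem_univ _⟩
    have hc_tend : Tendsto c atTop (𝓝[Icc a b ×ˢ univ] (tstar, xstar)) := by
      refine tendsto_nhdsWithin_iff.2 ⟨?_, Eventually.of_forall hcW⟩
      have : Tendsto (fun n => (t n, x n)) atTop (𝓝 (tstar, xstar)) := ht_tend.prodMk_nhds hx_tend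
      exact this
    have hF_tend : Tendsto (fun n => F (t n) (x n)) atTop (𝓝 (F tstar xstar)) := by
      have hFc : ContinuousWithinAt (uncurry F) (Icc a b ×ˢ univ) (tstar, xstar) :=
        hF _ ⟨⟨htstar_a, htstar_b⟩, mem_univ _⟩
      exact hFc.tendsto.comp hc_tend
    have hG_tend : Tendsto (fun n => infDist (x n + δs • F (t n) (x n)) D) atTop
        (𝓝 (infDist (xstar + δs • F tstar xstar) D)) :=
      ((continuous_infDist_pt D).tendsto _).comp (hx_tend.add (hF_tend.const_smul δs))
    have hlim_lt : infDist (xstar + δs • F tstar xstar) D < ε / 2 * δs := by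
      calc infDist (xstar + δs • F tstar xstar) D ≤ ε / 4 * δs := hδsdist
        _ < ε / 2 * δs := by nlinarith
    have hev1 : ∀ᶠ n in atTop, infDist (x n + δs • F (t n) (x n)) D < ε / 2 * δs :=
      (tendsto_order.1 hG_tend).2 _ hlim_lt
    -- eventually the steps are at least `δs / 2` ...
    have hev2 : ∀ᶠ n in atTop, δs / 2 < t (n + 1) - t n := by
      filter_upwards [hev1] with n hn
      have htn : t n < b := lt_of_le_of_lt (ht_le n) hlt
      have hAdm : Adm F D ε δbar b (c n) δs :=
        ⟨hδs0, hδs1, by show t n + δs ≤ b; linarith [ht_le n], hn⟩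
      have hbdd : BddAbove {δ | Adm F D ε δbar b (c n) δ} := ⟨δbar, fun δ hδ => hδ.2.1⟩
      have h1 : δs ≤ sSup {δ | Adm F D ε δbar b (c n) δ} := le_csSup hbdd hAdm
      have h2 := (hGood n htn).2.1
      show δs / 2 < t (n + 1) - t n
      change sSup {δ | Adm F D ε δbar b (c n) δ} < 2 * ((c (n + 1)).1 - (c n).1) at h2
      linarith
    -- ... but they tend to zero
    have hstep_tend : Tendsto (fun n => t (n + 1) - t n) atTop (𝓝 0) := by
      have := (ht_tend.comp (tendsto_add_atTop_nat 1)).sub ht_tend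
      simpa using this
    have hev3 : ∀ᶠ n in atTop, t (n + 1) - t n < δs / 2 :=
      (tendsto_order.1 hstep_tend).2 _ (by linarith)
    obtain ⟨n, hn1, hn2⟩ := (hev2.and hev3).exists
    linarith
  -- cover `τ` by a step `[t n, t (n+1)]`
  have hevτ : ∃ N, τ < t N := by
    have : ∀ᶠ n in atTop, τ < t n := (tendsto_order.1 ht_tend).1 τ (htstar_eq ▸ hτ.2)
    exact this.exists
  set N := Nat.find hevτ with hN_def
  have hN : τ < t N := Nat.find_spec hevτ
  have hN0 : N ≠ 0 := by
    intro h0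
    have : τ < t 0 := h0 ▸ hN
    simp [ht_def, hc0] at this
    linarith [hτ.1]
  obtain ⟨n, hn_eq⟩ := Nat.exists_eq_succ_of_ne_zero hN0
  have hN' : τ < t (n + 1) := by rw [← Nat.succ_eq_add_one, ← hn_eq]; exact hN
  have hn : t n ≤ τ := by
    have hlt : n < N := by rw [hn_eq]; exact Nat.lt_succ_self n
    rw [hN_def] at hlt
    exact not_lt.1 (Nat.find_min hevτ hlt)
  have htn : t n < b := lt_of_le_of_lt hn hτ.2
  have hG := hGood n htn
  have hδn : t (n + 1) - t n ≤ δbar := hG.1.2.1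
  have h1 : ‖u τ - u (t n)‖ ≤ Cu * (τ - t n) :=
    norm_sub_le_of_deriv_right_bound hcont hderiv (fun σ hσ => hCu σ (Ico_subset_Icc_self hσ))
      (hI1 n).1 hn hτ.2.le
  calc infDist (u τ) D ≤ dist (u τ) (x n) := infDist_le_dist_of_mem (hI1 n).2.2
    _ ≤ ‖u τ - u (t n)‖ + ‖u (t n) - x n‖ := by rw [dist_eq_norm]; exact norm_sub_le_norm_sub_add_norm_sub _ _ _
    _ ≤ Cu * (τ - t n) + ε * B₀ := add_le_add h1 (hEB n)
    _ ≤ Cu * ε + ε * B₀ := by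
        refine add_le_add (mul_le_mul_of_nonneg_left ?_ hCu0) le_rfl
        linarith [hN']
    _ = (Cu + B₀) * ε := by ring

/-- **Flow invariance of a closed set under the Nagumo subtangency condition** (Deimling's
Theorem 5.2 (ii) with `ω(t, ρ) = Lρ`; Brezis 1970 for autonomous fields; Volkmann; Martin 1973).
Let `E` be a real BANACH space, `D ⊆ E` closed, `F : [a, b] × E → E` jointly continuous and
`K`-Lipschitz in `x`, and suppose the SUBTANGENCY (Nagumo / Brezis boundary) condition
`liminf_{δ → 0+} δ⁻¹ dist(x + δ F(t, x), D) = 0` for every `t ∈ [a, b)` and every `x ∈ D`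
(automatic at interior points; stated as: for all `ε, δ₀ > 0` some `δ ∈ (0, δ₀)` has
`dist(x + δF(t,x), D) ≤ εδ`). Then every solution `u` of `u' = F(t, u)` on `[a, b]` (continuous on
`[a, b]`, right derivative `F(t, u t)` on `[a, b)`) with `u a ∈ D` stays in `D` on `[a, b]`.
Completeness is essential (Deimling's Example 5.2: a Lipschitz field on the wedge of non-negative
polynomials in an incomplete normed space, satisfying the boundary condition, whose solution leaves
the wedge). Proof (Deimling §4.2 + a discrete Grönwall comparison, `infDist_le_linear`): for every
`ε`, Euler polygons with corners in `D` and mesh `≤ ε` exist on all of `[a, b)` and stay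
`O(ε)`-close to `u`, so `dist(u t, D) = 0`. No convexity of `D` is needed.
[cite: Deimling1977, §5.2 Thm 5.2 (ii), p. 68, with §4.2 Lemma 4.2, pp. 51–52, and Example 5.2, pp. 68–69; Brezis1970; Martin1973] -/
theorem mem_of_ode_of_subtangent [CompleteSpace E] {D : Set E} (hD : IsClosed D)
    {F : ℝ → E → E} {u : ℝ → E} {a b : ℝ} {K : ℝ≥0}
    (hF : ContinuousOn (uncurry F) (Icc a b ×ˢ univ))
    (hlip : ∀ t ∈ Icc a b, LipschitzWith K (F t))
    (htan : ∀ t ∈ Ico a b, ∀ x ∈ D, ∀ ε : ℝ, 0 < ε → ∀ δ₀ : ℝ, 0 < δ₀ →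
      ∃ δ : ℝ, 0 < δ ∧ δ < δ₀ ∧ infDist (x + δ • F t x) D ≤ ε * δ)
    (hcont : ContinuousOn u (Icc a b))
    (hderiv : ∀ t ∈ Ico a b, HasDerivWithinAt u (F t (u t)) (Ici t) t)
    (ha : u a ∈ D) : ∀ t ∈ Icc a b, u t ∈ D := by
  have hDne : D.Nonempty := ⟨u a, ha⟩
  rcases le_or_gt b a with hba | hab
  · intro t ht
    have : t = a := le_antisymm (ht.2.trans hba) ht.1
    rw [this]; exact ha
  -- first on `[a, b)`
  have hIco : ∀ t ∈ Ico a b, u t ∈ D := by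
    obtain ⟨C, hC⟩ := infDist_le_linear hD hab hF hlip htan hcont hderiv ha
    intro t ht
    rw [hD.mem_iff_infDist_zero hDne]
    refine le_antisymm ?_ infDist_nonneg
    by_contra hpos
    push Not at hpos
    -- take `ε` small
    have hC0 : 0 ≤ C := by
      have := hC 1 one_pos t ht
      rw [mul_one] at this
      exact infDist_nonneg.trans this
    have := hC (infDist (u t) D / (2 * (C + 1))) (by positivity) t ht
    have h2 : C * (infDist (u t) D / (2 * (C + 1))) < infDist (u t) D := by
      rw [mul_div_assoc', div_lt_iff₀ (by positivity)]
      nlinarith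
    linarith
  -- then at `b` by closedness
  intro t ht
  rcases ht.2.lt_or_eq with hlt | heq
  · exact hIco t ⟨ht.1, hlt⟩
  rw [heq]
  have h1 : ContinuousWithinAt u (Ico a b) b :=
    (hcont b (right_mem_Icc.2 hab.le)).mono Ico_subset_Icc_self
  have h2 : b ∈ closure (Ico a b) := by rw [closure_Ico hab.ne]; exact right_mem_Icc.2 hab.le
  have h3 : u b ∈ closure (u '' Ico a b) := h1.mem_closure_image h2
  exact closure_minimal (image_subset_iff.2 fun s hs => hIco s hs) hD h3

/-! ### Convex sets: the functional form of the boundary condition (Deimling, Lemma 4.1) -/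

/-- **Deimling's Lemma 4.1, (4) ⇒ (3).** For a convex set `D`, a point `x ∈ D` and a vector `v`:
if every continuous functional attaining its supremum over `D` at `x` is non-positive on `v`
(`ψ y ≤ ψ x` for all `y ∈ D` implies `ψ v ≤ 0`), then `v` is subtangent to `D` at `x` in the
strong form: for every `ε > 0` there is `δ₀ > 0` with `dist(x + δ v, D) ≤ ε δ` for ALL
`δ ∈ (0, δ₀]`. Proof: `v` lies in the closed convex cone `closure {w | ∃ h > 0, x + h w ∈ D}`
(else `geometric_hahn_banach_point_closed` produces a functional contradicting the hypothesis),
and convexity propagates an approximation at one step length to all smaller ones.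
[cite: Deimling1977, §4.1 Lemma 4.1 ((4) ⇒ (3)), pp. 49–50] -/
theorem subtangent_of_convex_of_functional {D : Set E} (hDc : Convex ℝ D) {x : E} (hx : x ∈ D)
    {v : E} (hv : ∀ ψ : E →L[ℝ] ℝ, (∀ y ∈ D, ψ y ≤ ψ x) → ψ v ≤ 0) :
    ∀ ε : ℝ, 0 < ε → ∃ δ₀ : ℝ, 0 < δ₀ ∧ ∀ δ : ℝ, 0 < δ → δ ≤ δ₀ →
      infDist (x + δ • v) D ≤ ε * δ := by
  -- the cone of admissible directions
  set C : Set E := {w | ∃ h : ℝ, 0 < h ∧ x + h • w ∈ D} with hC_def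
  -- along an admissible direction one may shorten the step
  have hshort : ∀ (w : E) (h : ℝ), 0 < h → x + h • w ∈ D → ∀ δ : ℝ, 0 < δ → δ ≤ h →
      x + δ • w ∈ D := by
    intro w h hh hw δ hδ hδh
    have hle1 : δ / h ≤ 1 := (div_le_one hh).2 hδh
    have hconv := hDc hx hw (sub_nonneg.2 hle1) (by positivity : 0 ≤ δ / h) (by ring)
    have hcalc : (1 - δ / h) • x + (δ / h) • (x + h • w) = x + δ • w := by
      rw [smul_add, smul_smul, div_mul_cancel₀ _ hh.ne']
      module
    rwa [hcalc] at hconv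
  have hCconv : Convex ℝ C := by
    intro w₁ hw₁ w₂ hw₂ c₁ c₂ hc₁ hc₂ hsum
    obtain ⟨h₁, hh₁, hD₁⟩ := hw₁
    obtain ⟨h₂, hh₂, hD₂⟩ := hw₂
    refine ⟨min h₁ h₂, lt_min hh₁ hh₂, ?_⟩
    have h1 : x + min h₁ h₂ • w₁ ∈ D := hshort w₁ h₁ hh₁ hD₁ _ (lt_min hh₁ hh₂) (min_le_left _ _)
    have h2 : x + min h₁ h₂ • w₂ ∈ D := hshort w₂ h₂ hh₂ hD₂ _ (lt_min hh₁ hh₂) (min_le_right _ _)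
    have hconv := hDc h1 h2 hc₁ hc₂ hsum
    have hcalc : c₁ • (x + min h₁ h₂ • w₁) + c₂ • (x + min h₁ h₂ • w₂)
        = x + min h₁ h₂ • (c₁ • w₁ + c₂ • w₂) := by
      have hx' : c₁ • x + c₂ • x = x := by rw [← add_smul, hsum, one_smul]
      calc c₁ • (x + min h₁ h₂ • w₁) + c₂ • (x + min h₁ h₂ • w₂)
          = (c₁ • x + c₂ • x) + min h₁ h₂ • (c₁ • w₁ + c₂ • w₂) := by
            rw [smul_add, smul_add, smul_add, smul_comm c₁ (min h₁ h₂) w₁,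
              smul_comm c₂ (min h₁ h₂) w₂]
            abel
        _ = x + min h₁ h₂ • (c₁ • w₁ + c₂ • w₂) := by rw [hx']
    rwa [hcalc] at hconv
  have hCcone : ∀ w ∈ C, ∀ c : ℝ, 0 < c → c • w ∈ C := by
    rintro w ⟨h, hh, hD⟩ c hc
    refine ⟨h / c, div_pos hh hc, ?_⟩
    rwa [smul_smul, div_mul_cancel₀ _ hc.ne']
  have hC0 : (0 : E) ∈ C := ⟨1, one_pos, by simpa using hx⟩
  have hsub : ∀ y ∈ D, y - x ∈ C := fun y hy => ⟨1, one_pos, by simpa using hy⟩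
  -- `v ∈ closure C` by Hahn–Banach
  have hvT : v ∈ closure C := by
    by_contra hnot
    obtain ⟨f, u₀, hf1, hf2⟩ :=
      geometric_hahn_banach_point_closed (hCconv.closure) isClosed_closure hnot
    have hu₀ : u₀ < 0 := by simpa using hf2 0 (subset_closure hC0)
    have hfC : ∀ w ∈ C, 0 ≤ f w := by
      intro w hw
      by_contra hneg
      push Not at hneg
      -- scale `w` to push `f` below `u₀`
      have hmem : (u₀ / f w) • w ∈ C := hCcone w hw _ (div_pos_of_neg_of_neg hu₀ hneg)
      have := hf2 _ (subset_closure hmem)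
      rw [map_smul, smul_eq_mul, div_mul_cancel₀ _ hneg.ne] at this
      exact lt_irrefl _ this
    have hψ : ∀ y ∈ D, (-f) y ≤ (-f) x := by
      intro y hy
      have := hfC _ (hsub y hy)
      rw [map_sub] at this
      simp only [neg_apply, neg_le_neg_iff]
      linarith
    have h1 := hv (-f) hψ
    simp only [neg_apply, neg_nonpos] at h1
    linarith
  -- conclude
  intro ε hε
  obtain ⟨w, hwC, hvw⟩ := Metric.mem_closure_iff.1 hvT ε hε
  obtain ⟨h₀, hh₀, hD₀⟩ := hwC
  refine ⟨h₀, hh₀, fun δ hδ hδh => ?_⟩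
  have hmem : x + δ • w ∈ D := hshort w h₀ hh₀ hD₀ δ hδ hδh
  calc infDist (x + δ • v) D ≤ dist (x + δ • v) (x + δ • w) := infDist_le_dist_of_mem hmem
    _ = δ * dist v w := by
        rw [dist_eq_norm, dist_eq_norm, add_sub_add_left_eq_sub, ← smul_sub, norm_smul,
          Real.norm_eq_abs, abs_of_pos hδ]
    _ ≤ ε * δ := by rw [mul_comm]; exact mul_le_mul_of_nonneg_right hvw.le hδ.le

/-- **Flow invariance of a closed convex set, functional form of the boundary condition**
(Deimling Thm 5.2 (ii) + Lemma 4.1): `E` Banach, `D` closed convex, `F` jointly continuous on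
`[a, b] × E` and `K`-Lipschitz in `x`; if at every `t ∈ [a, b)` and `x ∈ D` every functional `ψ`
attaining its supremum over `D` at `x` satisfies `ψ (F t x) ≤ 0` (condition (4)), then solutions
starting in `D` stay in `D`. [cite: Deimling1977, §4.1 Lemma 4.1 and §5.2 Thm 5.2 (ii), pp. 49–50, 68] -/
theorem mem_of_ode_of_convex_of_functional [CompleteSpace E] {D : Set E} (hDc : Convex ℝ D)
    (hD : IsClosed D) {F : ℝ → E → E} {u : ℝ → E} {a b : ℝ} {K : ℝ≥0}
    (hF : ContinuousOn (uncurry F) (Icc a b ×ˢ univ))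
    (hlip : ∀ t ∈ Icc a b, LipschitzWith K (F t))
    (hbdry : ∀ t ∈ Ico a b, ∀ x ∈ D, ∀ ψ : E →L[ℝ] ℝ, (∀ y ∈ D, ψ y ≤ ψ x) → ψ (F t x) ≤ 0)
    (hcont : ContinuousOn u (Icc a b))
    (hderiv : ∀ t ∈ Ico a b, HasDerivWithinAt u (F t (u t)) (Ici t) t)
    (ha : u a ∈ D) : ∀ t ∈ Icc a b, u t ∈ D := by
  refine mem_of_ode_of_subtangent hD hF hlip ?_ hcont hderiv ha
  intro t ht x hx ε hε δ₀ hδ₀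
  obtain ⟨δ₁, hδ₁, h⟩ := subtangent_of_convex_of_functional hDc hx (hbdry t ht x hx) ε hε
  refine ⟨min δ₁ δ₀ / 2, by positivity, ?_, h _ (by positivity) ?_⟩
  · have := min_le_right δ₁ δ₀; linarith
  · have := min_le_left δ₁ δ₀; linarith

/-- **Nagumo–Brezis–Martin / Volkmann for a closed wedge, dual-wedge form** (Deimling's condition
(7), Example 4.1 (ii)): `E` a real Banach space, `W ⊆ E` a closed convex wedge (`0 ∈ W`, `λW ⊆ W`
for `λ > 0`), `W* = {ψ : ψ ≥ 0 on W}` its dual wedge, `F` jointly continuous on `[a, b] × E` and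
`K`-Lipschitz in `x`. If for every `t ∈ [a, b)`, every `x ∈ W` and every `ψ ∈ W*` with `ψ x = 0`
one has `ψ (F t x) ≥ 0` ("quasi-positivity"), then every solution of `u' = F(t, u)` with
`u a ∈ W` satisfies `u t ∈ W` on `[a, b]`. (At interior points no `ψ ∈ W* \ {0}` vanishes, so the
condition only bites on the boundary.) -- TODO(general form): `F` locally Lipschitz in `x`
(restrict to a ball around the compact trajectory). [cite: Deimling1977, §4.1 Example 4.1 (ii) (condition (7)) with §5.2 Thm 5.2 (ii), pp. 50, 68; Volkmann1973; Brezis1970; Martin1973] -/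
theorem mem_of_ode_of_wedge_of_dualWedge [CompleteSpace E] {W : Set E} (hWc : Convex ℝ W)
    (hW : IsClosed W) (hW0 : (0 : E) ∈ W) (hWsmul : ∀ ⦃c : ℝ⦄, 0 < c → ∀ ⦃y : E⦄, y ∈ W → c • y ∈ W)
    {F : ℝ → E → E} {u : ℝ → E} {a b : ℝ} {K : ℝ≥0}
    (hF : ContinuousOn (uncurry F) (Icc a b ×ˢ univ))
    (hlip : ∀ t ∈ Icc a b, LipschitzWith K (F t))
    (hqp : ∀ t ∈ Ico a b, ∀ x ∈ W, ∀ ψ : E →L[ℝ] ℝ, (∀ k ∈ W, 0 ≤ ψ k) → ψ x = 0 → 0 ≤ ψ (F t x))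
    (hcont : ContinuousOn u (Icc a b))
    (hderiv : ∀ t ∈ Ico a b, HasDerivWithinAt u (F t (u t)) (Ici t) t)
    (ha : u a ∈ W) : ∀ t ∈ Icc a b, u t ∈ W := by
  refine mem_of_ode_of_convex_of_functional hWc hW hF hlip ?_ hcont hderiv ha
  intro t ht x hx ψ hψ
  -- a functional attaining its sup over a wedge at `x` is `≤ 0` on the wedge and vanishes at `x`
  have hψW : ∀ k ∈ W, ψ k ≤ 0 := by
    intro k hk
    by_contra hpos
    push Not at hpos
    have hmem : ((ψ x + 1) / ψ k) • k ∈ W := by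
      rcases le_or_gt (ψ x + 1) 0 with hle | hgt
      · -- then `ψ x ≤ -1 < 0 = ψ 0 ≤ ψ x`, absurd
        have := hψ 0 hW0
        simp only [map_zero] at this
        linarith
      · exact hWsmul (div_pos hgt hpos) hk
    have := hψ _ hmem
    rw [map_smul, smul_eq_mul, div_mul_cancel₀ _ hpos.ne'] at this
    linarith
  have hψx : ψ x = 0 := by
    have h1 := hψ 0 hW0
    simp only [map_zero] at h1
    exact le_antisymm (hψW x hx) h1
  have := hqp t ht x hx (-ψ) (fun k hk => by simpa using hψW k hk) (by simp [hψx])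
  simpa using this

end ClosedSet

end Literature.Analysis.ODE
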